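import Summits.BirchSwinnertonDyer.BirchSwinnertonDyer.Theorems.PrintCf2SplitBadTwoTorsionStrictDualPointClasses
import Summits.BirchSwinnertonDyer.BirchSwinnertonDyer.Theorems.PrintCf2SplitBadTwoLevelEigenSplitting
import Summits.BirchSwinnertonDyer.Rank1Residual.X11b.KummerPoitouTateExact
import HarnessLib

/-!
# Crux `PrintCf2.SplitBadTwoRankOneOfFacts` (stmt-BirchSwinnertonDyer-20368), road α v10.3, S3c input (F3), piece (P2-loc) in Option A‴:
# `#H¹(K_v, E[p^N])_e = #E(K_v)[p^N] · #(𝓞_v ⧸ p^N)` for an isotropic splitting `e + e′ = 1` of `E[p^N]`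

Cell `bsd-print-cf2`, EXTRA WIDTH seat `bsd-line-cf2-p1-w4` g9 (prover-bsd-line-cf2-p1-w4-g9-0); `--supports stmt-BirchSwinnertonDyer-20368`
(helper, Theses-free). HONEST FRAMING: nothing here closes the crux or a registered stub; BSD is not proved by any of this; no summit
statement is proved by this seat. No definition, no named fact, no `sorry`. The local count that Option A‴ of the (F3) plan
(`Cruxes/SplitBadTwoRankOneOfFacts/F3-PLAN-w5g3.md`, this seat's DESIGN DECISION, -w3 g9 22:55Z withdrawal) still needs: with `𝓕_v = L_v = (N^E_v).comap H¹(e_N)`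
one has `#𝓕_v = #(N^E_v ∩ A) · #A′` and p675947 reads `[H¹_{𝓕[⊤ at v]} : H¹_𝓕] · #loc_v(H¹_{𝓕*}) · #(N^E_v ∩ A) = #A`, `A = H¹(e_N)(H¹(K_v, E[p^N]))` — so the ORDER
OF THE `e`-PART `A` is needed. No summand module and no summand Euler characteristic: `A` and `A′ = H¹(e′_N)(H¹(K_v, E[p^N]))` are each ISOTROPIC
for `inv_v(· ∪ₑ ·)` (p669287 `cupProduct_map_levelProj_eq_zero`), the pairing is perfect (X11b `KummerPT.invWeilPairing_flip_bijective`, local Tate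
duality), and `A + A′ = H¹(K_v, E[p^N])` (p669287 `map_restrictField_add_map_restrictField_eq`); hence `#A² ≤ #H¹`, `#A′² ≤ #H¹ ≤ #A · #A′`, so
`#A = #A′ = √#H¹(K_v, E[p^N]) = #E(K_v)[p^N] · #(𝓞_v ⧸ p^N)` (tree `natCard_galoisCohomology_one_torsion_adicCompletion_eq_sq`, Milne I Thm. 2.8 PROVED).

WHAT. `natCard_range_map_le_of_isotropic` (`#A² ≤ #H¹(K_v, E[p^N])` for ONE isotropic equivariant endomorphism), **`natCard_range_map_levelProj_eq`**
(`#A = #E(K_v)[p^N] · #(𝓞_v ⧸ p^N)` for an isotropic splitting `e_N + e′_N = 1`). Generic `W/K`, prime power `p^N`, finite `v`, Weil data `e`, family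
`inv` injective at `v` (`IsPerfect`). CM USE: `e_N, e′_N` = the level projectors onto `W*[2^N]`, `W*′[2^N]` (p669287 `exists_levelProj`; isotropy from
cyclicity, `weilPairingHom_apply_apply_eq_zero_of_cyclic` + `exists_forall_levelProj_eq_zsmul`); `K_v = ℚ₂` gives `#(𝓞_v ⧸ 2^N) = 2^N`.
presearch: Milne ADT I Cor. 2.3 / Thm. 2.8 (local duality, EP) → tree theorems; no new fact. beyond-print theorem: no.

References: [MilneADT2006] I Cor. 2.3, Thm. 2.8, §6 proof of Prop. 6.9; [SilvermanAEC2009] III.8.1; [NeukirchSchmidtWingberg2008] I §4 (1.4.2).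
-/

noncomputable section

open scoped Classical

set_option linter.dupNamespace false
set_option autoImplicit false

open Function Field NumberField IsDedekindDomain WeierstrassCurve
open Literature.NumberTheory.EllipticCurves
open Literature.NumberTheory.GaloisRepresentations
open Literature.NumberTheory.GaloisRepresentations.DiscreteGaloisModule (localTatePairingZMod tateDual SelmerStructure mu)
open Literature.NumberTheory.GaloisCohomology
open scoped ContRepresentation
open Summit.BirchSwinnertonDyer.Rank1Residual.X11b
open Summit.BirchSwinnertonDyer.Rank1Residual.X11b.LocBridge
open Summit.BirchSwinnertonDyer.Rank1Residual.X11b.Relaxation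
open Summit.BirchSwinnertonDyer.Rank1Residual.X11b.FiniteDuality

namespace Summit.BirchSwinnertonDyer.BirchSwinnertonDyer.Theorems.PrintCf2.RestrictedSelmerPair

section Local

variable {K : Type} [Field K] [NumberField K] (W : WeierstrassCurve K) [W.IsElliptic] (p : ℕ) [hp : Fact p.Prime] (N : ℕ)
  [NeZero (p ^ N)]
variable (e : W.geomTorsion ((p ^ N : ℕ) : ℤ) → W.geomTorsion ((p ^ N : ℕ) : ℤ) → AlgebraicClosure K)
  (hμ : ∀ S T, e S T ^ (p ^ N) = 1)
  (hadd₁ : ∀ S₁ S₂ T, e (S₁ + S₂) T = e S₁ T * e S₂ T)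
  (hadd₂ : ∀ S T₁ T₂, e S (T₁ + T₂) = e S T₁ * e S T₂)
  (hgal : ∀ (σ : absoluteGaloisGroup K) (S T : W.geomTorsion ((p ^ N : ℕ) : ℤ)), σ • e S T = e (σ • S) (σ • T))
  (hnondeg : ∀ T, (∀ S, e S T = 1) → T = 0)
  (inv : LocalInvariants K (p ^ N))

omit hp in
include hgal hnondeg in
/-- **`#A² ≤ #H¹(K_v, E[p^N])` for the image `A = H¹(η)(H¹(K_v, E[p^N]))` of an equivariant endomorphism `η` of `E[p^N]` on whose image the Weil
pairing vanishes**: `A` is isotropic for `inv_v(· ∪ₑ ·)` (p669287 `cupProduct_map_levelProj_eq_zero`), i.e. `A ≤ A^⊥`, and `#A^⊥ · #A = #H¹` since the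
right adjoint of `inv_v(· ∪ₑ ·)` is bijective (X11b `KummerPT.invWeilPairing_flip_bijective`, local Tate duality). [cite: MilneADT2006, I Cor. 2.3 and §6 proof of Prop. 6.9] -/
theorem natCard_range_map_le_of_isotropic (v : HeightOneSpectrum (𝓞 K)) (hinv : Injective (inv (Sum.inr v)))
    (η : (W.torsionGaloisModule ((p ^ N : ℕ) : ℤ)).toContRepresentation →ⁱL (W.torsionGaloisModule ((p ^ N : ℕ) : ℤ)).toContRepresentation)
    (hiso : ∀ x y, weilPairingHom W (p ^ N) e hμ hadd₁ hadd₂ (η x) (η y) = 0) :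
    Nat.card (galoisCohomology.map (η.restrictField (Place.Completion (Sum.inr v : Place K))) 1).range *
        Nat.card (galoisCohomology.map (η.restrictField (Place.Completion (Sum.inr v : Place K))) 1).range ≤
      Nat.card (galoisCohomology ((W.torsionGaloisModule ((p ^ N : ℕ) : ℤ)).toLocal (Sum.inr v)) 1) := by
  haveI := KummerPT.finite_galoisCohomology_toLocal_inr W (p ^ N) v
  haveI : Finite (galoisCohomology (GaloisRep.restrictField (Place.Completion (Sum.inr v : Place K))
      (W.torsionGaloisModule ((p ^ N : ℕ) : ℤ))) 1) := KummerPT.finite_galoisCohomology_toLocal_inr W (p ^ N) v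
  have hA0 : ∀ x : galoisCohomology ((W.torsionGaloisModule ((p ^ N : ℕ) : ℤ)).toLocal (Sum.inr v)) 1, (p ^ N) • x = 0 :=
    KummerPT.nsmul_galoisCohomology_toLocal_eq_zero W (p ^ N) (Sum.inr v)
  set b := invWeilPairing W (p ^ N) e hμ hadd₁ hadd₂ hgal inv (Sum.inr v) with hb
  have hflip : Bijective b.flip := KummerPT.invWeilPairing_flip_bijective W (p ^ N) e hμ hadd₁ hadd₂ hgal hnondeg inv v hinv
  set A := (galoisCohomology.map (η.restrictField (Place.Completion (Sum.inr v : Place K))) 1).range with hA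
  -- isotropy `A ≤ A^⊥`
  have hAA : A ≤ annRight b A := by
    rintro _ ⟨y, rfl⟩
    refine (mem_annRight_iff _ _ _).mpr ?_
    rintro _ ⟨x, rfl⟩
    haveI := absoluteGaloisGroup_compactSpace (Place.Completion (Sum.inr v : Place K))
    have hcup := LevelEigen.cupProduct_map_levelProj_eq_zero W (p ^ N) e hμ hadd₁ hadd₂ hgal (Place.Completion (Sum.inr v : Place K)) η hiso x y
    rw [hb]
    exact (congrArg (inv (Sum.inr v)) hcup).trans (map_zero _)
  have h1 : Nat.card (annRight b A) * Nat.card A = Nat.card (galoisCohomology ((W.torsionGaloisModule ((p ^ N : ℕ) : ℤ)).toLocal (Sum.inr v)) 1) :=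
    natCard_annRight_mul hA0 b hflip A
  calc Nat.card A * Nat.card A ≤ Nat.card (annRight b A) * Nat.card A :=
        Nat.mul_le_mul_right _ (AddSubgroup.card_le_of_le hAA)
    _ = _ := h1

include hgal hnondeg in
/-- **(P2-loc in Option A‴) `#H¹(e_N)(H¹(K_v, E[p^N])) = #E(K_v)[p^N] · #(𝓞_v ⧸ p^N)`** for an ISOTROPIC SPLITTING of `E[p^N]`: two equivariant endomorphisms
`e_N, e′_N` with `e_N x + e′_N x = x` on whose images the Weil pairing vanishes (the CM level projectors onto `W*[2^N]`, `W*′[2^N]`, p669287), `v` finite,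
`inv_v` injective, `N ≥ 1`. From `#A² ≤ #H¹`, `#A′² ≤ #H¹` (`natCard_range_map_le_of_isotropic`), `#H¹ ≤ #A · #A′` (`A + A′ = H¹`, p669287
`map_restrictField_add_map_restrictField_eq`) and `#H¹(K_v, E[p^N]) = (#E(K_v)[p^N] · #(𝓞_v ⧸ p^N))²` (Milne I Thm. 2.8 + Cor. 2.3, tree
`natCard_galoisCohomology_one_torsion_adicCompletion_eq_sq`, `hEP` discharged by `localEulerPoincareCharacteristic_holds`). No summand module is used.
[cite: MilneADT2006, I Cor. 2.3, Thm. 2.8] [cite: SilvermanAEC2009, Prop. III.8.1] -/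
theorem natCard_range_map_levelProj_eq (hN : 0 < N) (v : HeightOneSpectrum (𝓞 K)) (hinv : Injective (inv (Sum.inr v)))
    (eN eN' : (W.torsionGaloisModule ((p ^ N : ℕ) : ℤ)).toContRepresentation →ⁱL (W.torsionGaloisModule ((p ^ N : ℕ) : ℤ)).toContRepresentation)
    (hsum : ∀ x, eN x + eN' x = x)
    (hiso : ∀ x y, weilPairingHom W (p ^ N) e hμ hadd₁ hadd₂ (eN x) (eN y) = 0)
    (hiso' : ∀ x y, weilPairingHom W (p ^ N) e hμ hadd₁ hadd₂ (eN' x) (eN' y) = 0) :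
    Nat.card (galoisCohomology.map (eN.restrictField (Place.Completion (Sum.inr v : Place K))) 1).range =
      Nat.card (nsmulAddMonoidHom (p ^ N) : (W.baseChange (v.adicCompletion K)).toAffine.Point →+ _).ker *
        Nat.card (v.adicCompletionIntegers K ⧸ Ideal.span {((p ^ N : ℕ) : v.adicCompletionIntegers K)}) := by
  haveI hfin : Finite (galoisCohomology (GaloisRep.restrictField (Place.Completion (Sum.inr v : Place K))
      (W.torsionGaloisModule ((p ^ N : ℕ) : ℤ))) 1) := KummerPT.finite_galoisCohomology_toLocal_inr W (p ^ N) v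
  set H := galoisCohomology (GaloisRep.restrictField (Place.Completion (Sum.inr v : Place K))
      (W.torsionGaloisModule ((p ^ N : ℕ) : ℤ))) 1 with hH
  set A := (galoisCohomology.map (eN.restrictField (Place.Completion (Sum.inr v : Place K))) 1).range with hA
  set A' := (galoisCohomology.map (eN'.restrictField (Place.Completion (Sum.inr v : Place K))) 1).range with hA'
  set s := Nat.card (nsmulAddMonoidHom (p ^ N) : (W.baseChange (v.adicCompletion K)).toAffine.Point →+ _).ker *
    Nat.card (v.adicCompletionIntegers K ⧸ Ideal.span {((p ^ N : ℕ) : v.adicCompletionIntegers K)}) with hs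
  have hpp : IsPrimePow (p ^ N) := ⟨p, N, hp.out.prime, hN, rfl⟩
  have hHs : Nat.card H = s ^ 2 :=
    natCard_galoisCohomology_one_torsion_adicCompletion_eq_sq W v (p ^ N) hpp (localEulerPoincareCharacteristic_adicCompletion_of_numberField v)
  have hAle : Nat.card A * Nat.card A ≤ Nat.card H :=
    natCard_range_map_le_of_isotropic W p N e hμ hadd₁ hadd₂ hgal hnondeg inv v hinv eN hiso
  have hA'le : Nat.card A' * Nat.card A' ≤ Nat.card H :=
    natCard_range_map_le_of_isotropic W p N e hμ hadd₁ hadd₂ hgal hnondeg inv v hinv eN' hiso'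
  -- `A + A′ = H`: the map `A × A′ → H`, `(a, a′) ↦ a + a′` is onto
  have hsurj : Nat.card H ≤ Nat.card A * Nat.card A' := by
    rw [← Nat.card_prod]
    refine Nat.card_le_card_of_surjective (fun aa : A × A' ↦ (aa.1 : H) + (aa.2 : H)) fun h ↦ ?_
    refine ⟨(⟨galoisCohomology.map (eN.restrictField (Place.Completion (Sum.inr v : Place K))) 1 h, ⟨h, rfl⟩⟩,
      ⟨galoisCohomology.map (eN'.restrictField (Place.Completion (Sum.inr v : Place K))) 1 h, ⟨h, rfl⟩⟩), ?_⟩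
    exact LevelEigen.map_restrictField_add_map_restrictField_eq W p N (Place.Completion (Sum.inr v : Place K)) eN eN' hsum h
  -- arithmetic
  have hApos : 0 < Nat.card A := Nat.card_pos
  have hA'pos : 0 < Nat.card A' := Nat.card_pos
  have h3 : Nat.card A * Nat.card A ≤ Nat.card A * Nat.card A' := hAle.trans hsurj
  have h3' : Nat.card A' * Nat.card A' ≤ Nat.card A * Nat.card A' := hA'le.trans hsurj
  have h4 : Nat.card A ≤ Nat.card A' := Nat.le_of_mul_le_mul_left h3 hApos
  have h4' : Nat.card A' ≤ Nat.card A := by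
    rw [mul_comm (Nat.card A)] at h3'
    exact Nat.le_of_mul_le_mul_left h3' hA'pos
  have heq : Nat.card A' = Nat.card A := le_antisymm h4' h4
  rw [heq] at hsurj
  have hHs' : Nat.card H = s * s := by rw [hHs, sq]
  have hsq : Nat.card A * Nat.card A = s * s := (le_antisymm hAle hsurj).trans hHs'
  exact Nat.mul_self_inj.mp hsq

end Local

end Summit.BirchSwinnertonDyer.BirchSwinnertonDyer.Theorems.PrintCf2.RestrictedSelmerPair

end
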